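import Mathlib
import Literature.Analysis.FluidPDE.VorticityCalculus

/-!
# Crux `SlicedKelvin.PlanarFluxAPriori` (stmt-NavierStokesRegularity-15600), line `registered`:
  the `ε → 0⁺` bookkeeping of the heat-kernel domination step (helper for `stub_heatKernelDomination`)

The registered stub `stub_heatKernelDomination` of the skeleton `Cruxes/PlanarFluxAPriori/Lines/birth.lean`
bounds the unsigned planar vorticity flux `Φ(t;R,c) = ∫⁻ |f|`, `f = ⟪curl u(t), R e₂⟫` on the plane
`R{x₂ = c}`, by `sup_{c'} Φ(0;R,c') + C · liminf_{ε → 0⁺} G(ε)`, where `G(ε)` is the Duhamel-weighted bulk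
positive part of the `ε`-regularised fold-creation density. The analytic engine (the `ε`-fold law plus a
1-D heat-kernel comparison in the height `c`) delivers, for every FIXED `ε > 0`, an inequality for the
REGULARISED profile `φ_ε(t,c) = ∫⁻ (√(f² + ε²) − ε)`:

  `φ_ε(t,c) ≤ M + C · G(ε)`   for all small `ε > 0`.

This file proves, once and for all and in the exact `ℝ≥0∞` currency of the stub, the passage from the
family of `ε`-inequalities to the stub's `liminf` form:

* `sqrt_sq_add_sq_sub_le_abs`, `abs_sub_le_sqrt_sq_add_sq_sub`, `sqrt_sq_add_sq_sub_antitone`,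
  `tendsto_sqrt_sq_add_sq_sub` — the elementary facts `|s| − ε ≤ √(s²+ε²) − ε ≤ |s|`, antitone in
  `ε ≥ 0`, `→ |s|` as `ε → 0`;
* `lintegral_sqrt_sq_add_sq_sub_le` — `φ_ε ≤ Φ` (so the initial regularised profile is dominated by the
  initial flux, with NO measurability hypothesis: `lintegral` is monotone);
* `lintegral_enorm_eq_iSup_lintegral_sqrt_sq_add_sq_sub` — monotone convergence `Φ = ⨆ₙ φ_{ε₀/(n+2)}`
  for an a.e.-measurable `f`;
* `lintegral_enorm_le_add_mul_liminf` — THE REDUCTION: if `φ_ε ≤ M + C·G(ε)` for all `ε ∈ (0, ε₀)`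
  then `Φ ≤ M + C · liminf_{ε→0⁺} G` (`C : ℝ≥0`, `M : ℝ≥0∞`, `G : ℝ → ℝ≥0∞` arbitrary).

* `measurable_inner_curl_plane`, `planarFlux_le_of_forall_eps` — the reduction in the literal shape of
  the stub: the plane trace `y ↦ ⟪curl v (R(y₀,y₁,c)), R e₂⟫` is Borel measurable for EVERY field `v`
  (`curl = curlCLM ∘ D` and Mathlib's `measurable_fderiv`), so for a solution `u`, a frame `R`, a height
  `c` and times `0, t`: if `φ_ε(t,c) ≤ (⨆_{c'} φ_ε(0,c')) + C·G(ε)` for all `ε ∈ (0, ε₀)` then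
  `Φ(t;R,c) ≤ (⨆_{c'} Φ(0;R,c')) + C · liminf_{ε→0⁺} G` — what remains of `stub_heatKernelDomination`
  after this file is exactly the family of `ε`-level Duhamel inequalities.

Mathlib (`lintegral_iSup'`, `iSup_eq_of_tendsto`, `le_liminf_of_le`, `Monotone.map_liminf_of_continuousAt`,
`Real.sqrt_le_iff`, `measurable_fderiv`) and the tree's `curl_eq_curlCLM_comp` (`VorticityCalculus`).
-/

noncomputable section

-- Problem = summit for this single-conjunct summit: the duplicate namespace component is deliberate.
set_option linter.dupNamespace false

namespace Summit.NavierStokesRegularity.NavierStokesRegularity.Theorems.SlicedKelvinPlanarFluxAPriori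

open MeasureTheory Filter Set
open scoped ENNReal NNReal Topology

/-! ### The regularisation `√(s² + ε²) − ε` of `|s|` -/

/-- `|s| ≤ √(s² + ε²)`. -/
theorem abs_le_sqrt_sq_add_sq (s ε : ℝ) : |s| ≤ Real.sqrt (s ^ 2 + ε ^ 2) := by
  rw [← Real.sqrt_sq_eq_abs]
  exact Real.sqrt_le_sqrt (by nlinarith)

/-- `√(s² + ε²) − ε ≤ |s|` for `ε ≥ 0`: the regularised modulus is dominated by the modulus. -/
theorem sqrt_sq_add_sq_sub_le_abs (s : ℝ) {ε : ℝ} (hε : 0 ≤ ε) :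
    Real.sqrt (s ^ 2 + ε ^ 2) - ε ≤ |s| := by
  have h : Real.sqrt (s ^ 2 + ε ^ 2) ≤ |s| + ε := by
    rw [Real.sqrt_le_iff]
    refine ⟨by positivity, ?_⟩
    nlinarith [abs_nonneg s, sq_abs s]
  linarith

/-- `|s| − ε ≤ √(s² + ε²) − ε`: the regularisation error is at most `ε`. -/
theorem abs_sub_le_sqrt_sq_add_sq_sub (s ε : ℝ) :
    |s| - ε ≤ Real.sqrt (s ^ 2 + ε ^ 2) - ε := by
  linarith [abs_le_sqrt_sq_add_sq s ε]

/-- `0 ≤ √(s² + ε²) − ε` for `ε ≥ 0`. -/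
theorem sqrt_sq_add_sq_sub_nonneg (s : ℝ) {ε : ℝ} (hε : 0 ≤ ε) :
    0 ≤ Real.sqrt (s ^ 2 + ε ^ 2) - ε := by
  have : ε ≤ Real.sqrt (s ^ 2 + ε ^ 2) := by
    calc ε = Real.sqrt (ε ^ 2) := (Real.sqrt_sq hε).symm
      _ ≤ Real.sqrt (s ^ 2 + ε ^ 2) := Real.sqrt_le_sqrt (by nlinarith)
  linarith

/-- `ε ↦ √(s² + ε²) − ε` is antitone on `[0, ∞)`: smaller `ε` gives a larger regularised modulus
(its derivative is `ε/√(s²+ε²) − 1 ≤ 0`; here by squaring). -/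
theorem sqrt_sq_add_sq_sub_antitone (s : ℝ) {ε ε' : ℝ} (hε : 0 ≤ ε) (h : ε ≤ ε') :
    Real.sqrt (s ^ 2 + ε' ^ 2) - ε' ≤ Real.sqrt (s ^ 2 + ε ^ 2) - ε := by
  have h1 : ε ≤ Real.sqrt (s ^ 2 + ε ^ 2) := by
    calc ε = Real.sqrt (ε ^ 2) := (Real.sqrt_sq hε).symm
      _ ≤ Real.sqrt (s ^ 2 + ε ^ 2) := Real.sqrt_le_sqrt (by nlinarith)
  have h2 : Real.sqrt (s ^ 2 + ε' ^ 2) ≤ Real.sqrt (s ^ 2 + ε ^ 2) + (ε' - ε) := by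
    rw [Real.sqrt_le_iff]
    refine ⟨by linarith [Real.sqrt_nonneg (s ^ 2 + ε ^ 2)], ?_⟩
    nlinarith [Real.sq_sqrt (show (0 : ℝ) ≤ s ^ 2 + ε ^ 2 by positivity),
      Real.sqrt_nonneg (s ^ 2 + ε ^ 2)]
  linarith

/-- `√(s² + ε²) − ε → |s|` as `ε → 0` (continuity of `√·`). -/
theorem tendsto_sqrt_sq_add_sq_sub (s : ℝ) :
    Tendsto (fun ε : ℝ => Real.sqrt (s ^ 2 + ε ^ 2) - ε) (𝓝 0) (𝓝 |s|) := by
  have hc : Continuous fun ε : ℝ => Real.sqrt (s ^ 2 + ε ^ 2) - ε := by fun_prop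
  have h := hc.tendsto 0
  simp only [ne_eq, OfNat.ofNat_ne_zero, not_false_eq_true, zero_pow, add_zero, sub_zero,
    Real.sqrt_sq_eq_abs] at h
  exact h

/-! ### Lower integrals of the regularised modulus -/

section Lintegral

variable {α : Type*} [MeasurableSpace α] {μ : Measure α}

/-- `φ_ε ≤ Φ`: the lower integral of the regularised modulus is at most that of the modulus
(no measurability needed). -/
theorem lintegral_sqrt_sq_add_sq_sub_le (f : α → ℝ) {ε : ℝ} (hε : 0 ≤ ε) :
    ∫⁻ a, ENNReal.ofReal (Real.sqrt (f a ^ 2 + ε ^ 2) - ε) ∂μ ≤ ∫⁻ a, ‖f a‖ₑ ∂μ := by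
  refine lintegral_mono fun a => ?_
  rw [Real.enorm_eq_ofReal_abs]
  exact ENNReal.ofReal_le_ofReal (sqrt_sq_add_sq_sub_le_abs (f a) hε)

/-- `φ_ε` is antitone in `ε ≥ 0` (no measurability needed). -/
theorem lintegral_sqrt_sq_add_sq_sub_antitone (f : α → ℝ) {ε ε' : ℝ} (hε : 0 ≤ ε) (h : ε ≤ ε') :
    ∫⁻ a, ENNReal.ofReal (Real.sqrt (f a ^ 2 + ε' ^ 2) - ε') ∂μ ≤
      ∫⁻ a, ENNReal.ofReal (Real.sqrt (f a ^ 2 + ε ^ 2) - ε) ∂μ :=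
  lintegral_mono fun a => ENNReal.ofReal_le_ofReal (sqrt_sq_add_sq_sub_antitone (f a) hε h)

/-- The regularised integrand is a.e.-measurable when `f` is. -/
theorem aemeasurable_ofReal_sqrt_sq_add_sq_sub {f : α → ℝ} (hf : AEMeasurable f μ) (ε : ℝ) :
    AEMeasurable (fun a => ENNReal.ofReal (Real.sqrt (f a ^ 2 + ε ^ 2) - ε)) μ := by
  have h1 : AEMeasurable (fun a => f a ^ 2 + ε ^ 2) μ := (hf.pow_const 2).add_const _
  have h2 : AEMeasurable (fun a => Real.sqrt (f a ^ 2 + ε ^ 2)) μ :=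
    Real.continuous_sqrt.measurable.comp_aemeasurable h1
  exact ENNReal.measurable_ofReal.comp_aemeasurable (h2.sub_const ε)

/-- **Monotone convergence in `ε`.** For an a.e.-measurable `f` and `ε₀ > 0`, along the sequence
`εₙ = ε₀/(n+2) ↓ 0` the regularised profiles increase to the unsigned one:
`∫⁻ ‖f‖ₑ = ⨆ₙ ∫⁻ (√(f² + εₙ²) − εₙ)`. -/
theorem lintegral_enorm_eq_iSup_lintegral_sqrt_sq_add_sq_sub {f : α → ℝ} (hf : AEMeasurable f μ)
    {ε₀ : ℝ} (hε₀ : 0 < ε₀) :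
    ∫⁻ a, ‖f a‖ₑ ∂μ =
      ⨆ n : ℕ, ∫⁻ a, ENNReal.ofReal (Real.sqrt (f a ^ 2 + (ε₀ / (n + 2)) ^ 2) - ε₀ / (n + 2)) ∂μ := by
  set e : ℕ → ℝ := fun n => ε₀ / (n + 2) with he
  have he_pos : ∀ n, 0 < e n := fun n => by positivity
  have he_anti : Antitone e := by
    intro m n hmn
    have hm : (0 : ℝ) < m + 2 := by positivity
    have hmn' : (m : ℝ) + 2 ≤ n + 2 := by exact_mod_cast Nat.add_le_add_right hmn 2
    exact div_le_div_of_nonneg_left hε₀.le hm hmn'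
  have he_tendsto : Tendsto e atTop (𝓝 0) := by
    have h2 : Tendsto (fun n : ℕ => (n : ℝ) + 2) atTop atTop :=
      tendsto_natCast_atTop_atTop.atTop_add tendsto_const_nhds
    exact tendsto_const_nhds.div_atTop h2
  set g : ℕ → α → ℝ≥0∞ := fun n a => ENNReal.ofReal (Real.sqrt (f a ^ 2 + e n ^ 2) - e n) with hg
  have hg_meas : ∀ n, AEMeasurable (g n) μ := fun n => aemeasurable_ofReal_sqrt_sq_add_sq_sub hf (e n)
  have hg_mono : ∀ a, Monotone fun n => g n a := fun a m n hmn =>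
    ENNReal.ofReal_le_ofReal (sqrt_sq_add_sq_sub_antitone (f a) (he_pos n).le (he_anti hmn))
  have hg_sup : ∀ a, ⨆ n, g n a = ‖f a‖ₑ := by
    intro a
    refine iSup_eq_of_tendsto (hg_mono a) ?_
    have h1 : Tendsto (fun n => Real.sqrt (f a ^ 2 + e n ^ 2) - e n) atTop (𝓝 |f a|) :=
      (tendsto_sqrt_sq_add_sq_sub (f a)).comp he_tendsto
    have h2 := (ENNReal.continuous_ofReal.tendsto _).comp h1
    rw [Real.enorm_eq_ofReal_abs]
    exact h2
  change ∫⁻ a, ‖f a‖ₑ ∂μ = ⨆ n : ℕ, ∫⁻ a, g n a ∂μ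
  rw [← lintegral_iSup' hg_meas (Eventually.of_forall hg_mono)]
  exact lintegral_congr fun a => (hg_sup a).symm

/-- **The `ε → 0⁺` reduction of the heat-kernel domination stub.** Let `f` be a.e.-measurable and
suppose the regularised profiles obey `∫⁻ (√(f² + ε²) − ε) ≤ M + C · G(ε)` for every `ε ∈ (0, ε₀)`.
Then `∫⁻ ‖f‖ₑ ≤ M + C · liminf_{ε → 0⁺} G` (`liminf` along `𝓝[>] 0`, in `ℝ≥0∞`). Proof: along
`εₙ ↓ 0` the profiles increase to `∫⁻ ‖f‖ₑ`; each `φ_{εₙ}` is `≤ M + C·G(ε)` for every `ε ∈ (0, εₙ]`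
(antitonicity), hence `≤ liminf (M + C·G) = M + C·liminf G` (the affine map is monotone and
continuous on `ℝ≥0∞` since `C < ∞`). -/
theorem lintegral_enorm_le_add_mul_liminf {f : α → ℝ} (hf : AEMeasurable f μ) {M : ℝ≥0∞} {C : ℝ≥0}
    {G : ℝ → ℝ≥0∞} {ε₀ : ℝ} (hε₀ : 0 < ε₀)
    (h : ∀ ε ∈ Set.Ioo 0 ε₀,
      ∫⁻ a, ENNReal.ofReal (Real.sqrt (f a ^ 2 + ε ^ 2) - ε) ∂μ ≤ M + C * G ε) :
    ∫⁻ a, ‖f a‖ₑ ∂μ ≤ M + (C : ℝ≥0∞) * Filter.liminf G (𝓝[>] (0 : ℝ)) := by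
  rw [lintegral_enorm_eq_iSup_lintegral_sqrt_sq_add_sq_sub hf hε₀]
  refine iSup_le fun n => ?_
  have hen_pos : 0 < ε₀ / (n + 2) := by positivity
  have hen_lt : ε₀ / (n + 2) < ε₀ := by
    rw [div_lt_iff₀ (by positivity)]
    nlinarith
  have hev : ∀ᶠ ε in 𝓝[>] (0 : ℝ),
      ∫⁻ a, ENNReal.ofReal (Real.sqrt (f a ^ 2 + (ε₀ / (n + 2)) ^ 2) - ε₀ / (n + 2)) ∂μ ≤
        M + C * G ε := by
    filter_upwards [Ioo_mem_nhdsGT hen_pos] with ε hε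
    exact (lintegral_sqrt_sq_add_sq_sub_antitone f hε.1.le hε.2.le).trans
      (h ε ⟨hε.1, hε.2.trans hen_lt⟩)
  have hmono : Monotone fun x : ℝ≥0∞ => M + (C : ℝ≥0∞) * x := fun x y hxy => by
    dsimp only
    gcongr
  have hcont : Continuous fun x : ℝ≥0∞ => M + (C : ℝ≥0∞) * x :=
    continuous_const.add (ENNReal.continuous_const_mul ENNReal.coe_ne_top)
  calc ∫⁻ a, ENNReal.ofReal (Real.sqrt (f a ^ 2 + (ε₀ / (n + 2)) ^ 2) - ε₀ / (n + 2)) ∂μ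
      ≤ Filter.liminf (fun ε => M + (C : ℝ≥0∞) * G ε) (𝓝[>] (0 : ℝ)) := le_liminf_of_le (h := hev)
    _ = M + (C : ℝ≥0∞) * Filter.liminf G (𝓝[>] (0 : ℝ)) :=
        (hmono.map_liminf_of_continuousAt G hcont.continuousAt).symm

end Lintegral

/-! ### The reduction in the literal shape of the stub -/

section Plane

open Literature.Analysis.FluidPDE

/-- The curl of ANY field `v : ℝ³ → ℝ³` is Borel measurable: `curl v = curlCLM ∘ Dv`
(`curl_eq_curlCLM_comp`) and `x ↦ Dv(x)` is measurable (Mathlib `measurable_fderiv`, junk value `0`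
off the differentiability set included). (Local copy of `measurable_curl` of `CollapseDebris.lean`, whose
import closure is not wanted here.) -/
theorem measurable_curl' (v : EuclideanSpace ℝ (Fin 3) → EuclideanSpace ℝ (Fin 3)) :
    Measurable (curl v) := by
  rw [curl_eq_curlCLM_comp]
  exact curlCLM.continuous.measurable.comp (measurable_fderiv ℝ v)

/-- The height-`c` leaf of the foliation `R{x₂ = c}`: `y ↦ R (y₀, y₁, c)` is continuous. -/
theorem continuous_plane (R : EuclideanSpace ℝ (Fin 3) ≃ₗᵢ[ℝ] EuclideanSpace ℝ (Fin 3)) (c : ℝ) :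
    Continuous fun y : EuclideanSpace ℝ (Fin 2) => R (WithLp.toLp 2 ![y 0, y 1, c]) := by
  refine R.continuous.comp ?_
  refine (PiLp.continuous_toLp 2 _).comp ?_
  refine continuous_pi fun i => ?_
  fin_cases i
  · simpa using (PiLp.continuous_apply 2 (fun _ : Fin 2 => ℝ) 0)
  · simpa using (PiLp.continuous_apply 2 (fun _ : Fin 2 => ℝ) 1)
  · simpa using continuous_const

/-- The plane trace of the normal vorticity, `y ↦ ⟪curl v (R(y₀,y₁,c)), R e₂⟫`, is Borel measurable for
every field `v` (no regularity needed). -/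
theorem measurable_inner_curl_plane (v : EuclideanSpace ℝ (Fin 3) → EuclideanSpace ℝ (Fin 3))
    (R : EuclideanSpace ℝ (Fin 3) ≃ₗᵢ[ℝ] EuclideanSpace ℝ (Fin 3)) (c : ℝ) :
    Measurable fun y : EuclideanSpace ℝ (Fin 2) =>
      inner ℝ (curl v (R (WithLp.toLp 2 ![y 0, y 1, c]))) (R (EuclideanSpace.single 2 1)) :=
  ((measurable_curl' v).comp (continuous_plane R c).measurable).inner_const

/-- **`stub_heatKernelDomination` reduced to its `ε`-level Duhamel inequalities.** For a field
`u : ℝ → ℝ³ → ℝ³`, a frame `R`, a height `c`, a time `t`, a weight `C : ℝ≥0` and any `G : ℝ → ℝ≥0∞`: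
if for every `ε ∈ (0, ε₀)` the regularised flux profile at `(t, c)` is dominated by the sup over heights
of the regularised initial profile plus `C · G(ε)`, then the unsigned flux at `(t, c)` is dominated by the
sup over heights of the initial unsigned flux plus `C · liminf_{ε→0⁺} G` — the literal conclusion of the
stub once `G` is its Duhamel fold-creation integral. (`lintegral_enorm_le_add_mul_liminf` with
`M = ⨆_{c'} Φ(0;R,c')`, after `φ_ε(0,c') ≤ Φ(0;R,c')`.) -/
theorem planarFlux_le_of_forall_eps : ∀ (u : ℝ → EuclideanSpace ℝ (Fin 3) → EuclideanSpace ℝ (Fin 3)) (t : ℝ) (R : EuclideanSpace ℝ (Fin 3) ≃ₗᵢ[ℝ] EuclideanSpace ℝ (Fin 3)) (c : ℝ) (C : NNReal) (G : ℝ → ENNReal) (ε₀ : ℝ), 0 < ε₀ → (∀ ε ∈ Set.Ioo 0 ε₀, ∫⁻ y : EuclideanSpace ℝ (Fin 2), ENNReal.ofReal (Real.sqrt (inner ℝ (Literature.Analysis.FluidPDE.curl (u t) (R (WithLp.toLp 2 ![y 0, y 1, c]))) (R (EuclideanSpace.single 2 1)) ^ 2 + ε ^ 2) - ε) ≤ (⨆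 c' : ℝ, ∫⁻ y : EuclideanSpace ℝ (Fin 2), ENNReal.ofReal (Real.sqrt (inner ℝ (Literature.Analysis.FluidPDE.curl (u 0) (R (WithLp.toLp 2 ![y 0, y 1, c']))) (R (EuclideanSpace.single 2 1)) ^ 2 + ε ^ 2) - ε)) + (C : ENNReal) * G ε) → ∫⁻ y : EuclideanSpace ℝ (Fin 2), ‖inner ℝ (Literature.Analysis.FluidPDE.curl (u t) (R (WithLp.toLp 2 ![y 0, y 1, c]))) (R (EuclideanSpace.single 2 1))‖ₑ ≤ (⨆ c' : ℝ, ∫⁻ y : EuclideanSpace ℝ (Fin 2), ‖inner ℝ (Literature.Analysis.FluidPDE.curl (u 0) (R (WithLp.toLp 2 ![y 0, y 1, c']))) (R (EuclideanSpace.single 2 1))‖ₑ) + (C : ENNReal) * Filter.liminf G (nhdsWithin 0 (Set.Ioi 0)) := by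
  intro u t R c C G ε₀ hε₀ h
  refine lintegral_enorm_le_add_mul_liminf (measurable_inner_curl_plane (u t) R c).aemeasurable hε₀
    fun ε hε => (h ε hε).trans ?_
  refine add_le_add (iSup_mono fun c' => ?_) le_rfl
  exact lintegral_sqrt_sq_add_sq_sub_le (μ := volume) (fun y : EuclideanSpace ℝ (Fin 2) =>
    inner ℝ (curl (u 0) (R (WithLp.toLp 2 ![y 0, y 1, c']))) (R (EuclideanSpace.single 2 1))) hε.1.le

end Plane

end Summit.NavierStokesRegularity.NavierStokesRegularity.Theorems.SlicedKelvinPlanarFluxAPriori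

end
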